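import Literature.Analysis.FluidPDE.AxisymOmegaEnergy
import HarnessLib

/-!
# The `L⁴` energy identity of `V = v^θ/√r` and the Hardy-type bound `‖r⁻¹V²‖₂² ≤ 4 ∫ r² Φ² |∇Φ|²`
# (Lei–Zhang 2017, §4, (7-2)), in the smooth variable `Φ = v^θ/r`

Analysis/FluidPDE proof file (theorems only; no definitions, no named facts) on the discharge path
of the named fact `Literature.Analysis.FluidPDE.LeiZhang2017_smallSwirl_regularity`
(Lei–Zhang 2017, Thm. 1.4).

Lei–Zhang (arXiv:1505.02628, §4, p. 10) run an `L⁴` energy estimate for `V = v^θ/√r`: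

> "one can apply `L⁴` energy estimate for `V` to get
> `d/dt ‖V²‖²_{L²} + ‖∇|V|²‖²_{L²} + ‖r⁻¹|V|²‖²_{L²} ≲ ‖vʳ/r‖_{L^∞} ‖V‖⁴_{L⁴}`"   (7-2)

In the smooth Hou–Li variable `Φ = angVelQuot u = v^θ/r` (`AxisymHouLiVariables.lean`; `V² = r Φ²`,
`‖V²‖²_{L²} = ∫ r²Φ⁴`, `‖r⁻¹V²‖²_{L²} = ∫ Φ⁴`, `‖∇V²‖² + ‖r⁻¹V²‖² = 4∫ r²Φ²|∇Φ|²`) the computation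
behind (7-2) is the following pair of fixed-time statements, proved here by whole-space
integrations by parts under square-integrability hypotheses (no cut-offs):

* `integral_horizSq_mul_cube_mul_eq_of_phi_eq` — **the identity**: if `G ∈ C²` is an axisymmetric
  scalar obeying pointwise `G' + DG[b] = ν (ΔG + 2 radDerivQuot G) − 2 W G` (the `Φ`-equation of
  the tree, `IsClassicalNSSolutionOn.angVelQuot_eq`, `W = vʳ/r`) with `b ∈ C¹` divergence free,
  bounded with bounded derivative, `x₀b₀ + x₁b₁ = r² W`, and `G, ∂ᵢG, ∂ᵢ∂ᵢG, G' ∈ L²`, `G`, `r²G²`,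
  `W` bounded, then
  `∫ r² G³ G' = −3ν ∫ r² G² |∇G|² − (3/2) ∫ r² W G⁴`
  (the transport term gives `+½ ∫ r²WG⁴` since `D(r²)[b] = 2 r² W`; the boundary terms of
  `ν∫ r²G³ΔG` against `2ν ∫ r²G³ radDerivQuot G = 2ν ∫ G³ DG[x_h]` cancel exactly), i.e.
  `d/dt ∫ r²Φ⁴ = 4∫ r²Φ³Φ' = −12ν ∫ r²Φ²|∇Φ|² − 6 ∫ r² W Φ⁴`;
* `integral_pow_four_le_four_mul` — **the Hardy-type bound** `∫ G⁴ ≤ 4 ∫ r² G² (|∂₀G|² + |∂₁G|²)`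
  (`2∫G⁴ = −Σ_{i<2} ∫ xᵢ ∂ᵢ(G⁴) ≤ 4 (∫G⁴)^{1/2} (∫ r²G²|∇ₕG|²)^{1/2}`), the smooth form of
  `‖r⁻¹V²‖ ≤ ‖∇V²‖ + …`;
* `IsClassicalNSSolutionOn.integral_horizSq_mul_angVelQuot_cube_eq` — the identity for a classical
  axisymmetric solution at a time `t`, `G = Φ = angVelQuot (u t)`, `G' = angVelQuot (∂ₜu t)`,
  `W = radVelQuot (u t)`, from `IsClassicalNSSolutionOn.angVelQuot_eq`.

## Mathlib / tree search

Tree: `IsClassicalNSSolutionOn.angVelQuot_eq`, `fderiv_rho_apply`, `hasFDerivAt_rho`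
(`AxisymQuotientEquations`), `fderiv_apply_eq_sum_three` (`AxisymOmegaEnergy`),
`fderiv_apply_horizontal_eq` (`AxisymRadialQuotient`), `laplacian_eq_sum_fderiv_fderiv`
(`WholeSpaceIBP`), `divergence_eq_sum_three`, `fderiv_apply_coord_vec3`, `contDiff_apply_coord_vec3`,
`IsAxisymmetric.cylRadius_sq_mul_angVelQuot / _radVelQuot` (`AxisymHouLiVariables`);
`J = −∂_zΦ` is the tree's `IsAxisymmetric.radVelQuot_curl_eq_neg_fderiv_angVelQuot`
(`AxisymQuotientBounds`, not used here).  Mathlib: `integral_mul_fderiv_eq_neg_fderiv_mul_of_integrable`,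
`Integrable.bdd_mul`, `MemLp.integrable_mul`, `integral_mul_le_Lp_mul_Lq_of_nonneg`.
`lean search 'pow_four_le_four_mul|cube_mul_eq_of_phi'`: nothing before this file.

## References

* Z. Lei, Q. S. Zhang, Pacific J. Math. 289 (2017) 169–187, arXiv:1505.02628, §4, (7-2) (p. 10).
  [`LeiZhang2017`]
* T. Y. Hou, C. Li, Comm. Pure Appl. Math. 61 (2008) 661–697, §2. [folklore]
-/

noncomputable section

open MeasureTheory Set Function Filter Topology InnerProductSpace WithLp
open scoped RealInnerProductSpace Laplacian ContDiff ENNReal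

namespace Literature.Analysis.FluidPDE

/-! ### Two integrations by parts against the weight `r² = x₀² + x₁²` -/

section IBP

variable {G : EuclideanSpace ℝ (Fin 3) → ℝ} {b : EuclideanSpace ℝ (Fin 3) → EuclideanSpace ℝ (Fin 3)}

/-- `∂ᵥ (G⁴) = 4 G³ ∂ᵥG`. [folklore] -/
theorem fderiv_pow_four_apply {x : EuclideanSpace ℝ (Fin 3)} (hG : DifferentiableAt ℝ G x)
    (v : EuclideanSpace ℝ (Fin 3)) :
    fderiv ℝ (fun y => G y ^ 4) x v = 4 * G x ^ 3 * fderiv ℝ G x v := by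
  rw [(hG.hasFDerivAt.pow 4).fderiv]
  simp only [_root_.FunLike.coe_smul, Pi.smul_apply, smul_eq_mul]
  ring

/-- `∂ᵥ (G³) = 3 G² ∂ᵥG`. [folklore] -/
theorem fderiv_pow_three_apply {x : EuclideanSpace ℝ (Fin 3)} (hG : DifferentiableAt ℝ G x)
    (v : EuclideanSpace ℝ (Fin 3)) :
    fderiv ℝ (fun y => G y ^ 3) x v = 3 * G x ^ 2 * fderiv ℝ G x v := by
  rw [(hG.hasFDerivAt.pow 3).fderiv]
  simp only [_root_.FunLike.coe_smul, Pi.smul_apply, smul_eq_mul]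
  ring

/-- **Transport by parts, per coordinate**: `∫ r² bᵢ · 4G³∂ᵢG = −∫ (∂ᵢ(r²) bᵢ + r² ∂ᵢbᵢ) G⁴`
(`G`, `b` differentiable; the three products integrable). [folklore] -/
theorem integral_horizSq_mul_coord_mul_fderiv_pow_four (hG : Differentiable ℝ G)
    (hb : Differentiable ℝ b) (i : Fin 3)
    (ifg : Integrable (fun x : EuclideanSpace ℝ (Fin 3) => (x 0 ^ 2 + x 1 ^ 2) * b x i * G x ^ 4) volume)
    (ifg' : Integrable (fun x : EuclideanSpace ℝ (Fin 3) => (x 0 ^ 2 + x 1 ^ 2) * b x i *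
      (4 * G x ^ 3 * fderiv ℝ G x (EuclideanSpace.single i 1))) volume)
    (if'g : Integrable (fun x : EuclideanSpace ℝ (Fin 3) =>
      (fderiv ℝ (fun y : EuclideanSpace ℝ (Fin 3) => y 0 ^ 2 + y 1 ^ 2) x (EuclideanSpace.single i 1) * b x i +
        (x 0 ^ 2 + x 1 ^ 2) * fderiv ℝ b x (EuclideanSpace.single i 1) i) * G x ^ 4) volume) :
    ∫ x : EuclideanSpace ℝ (Fin 3), (x 0 ^ 2 + x 1 ^ 2) * b x i *
        (4 * G x ^ 3 * fderiv ℝ G x (EuclideanSpace.single i 1)) =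
      -∫ x : EuclideanSpace ℝ (Fin 3),
        (fderiv ℝ (fun y : EuclideanSpace ℝ (Fin 3) => y 0 ^ 2 + y 1 ^ 2) x (EuclideanSpace.single i 1) * b x i +
          (x 0 ^ 2 + x 1 ^ 2) * fderiv ℝ b x (EuclideanSpace.single i 1) i) * G x ^ 4 := by
  set e : EuclideanSpace ℝ (Fin 3) := EuclideanSpace.single i 1 with he
  have hρd : Differentiable ℝ fun y : EuclideanSpace ℝ (Fin 3) => y 0 ^ 2 + y 1 ^ 2 :=
    fun y => (hasFDerivAt_rho y).differentiableAt
  have hbid : Differentiable ℝ fun x => b x i := fun x =>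
    ((EuclideanSpace.proj (𝕜 := ℝ) i).differentiableAt).comp x (hb x)
  have hf : Differentiable ℝ fun x : EuclideanSpace ℝ (Fin 3) => (x 0 ^ 2 + x 1 ^ 2) * b x i :=
    hρd.mul hbid
  have hg : Differentiable ℝ fun x => G x ^ 4 := hG.pow 4
  have hDf : ∀ x, fderiv ℝ (fun y : EuclideanSpace ℝ (Fin 3) => (y 0 ^ 2 + y 1 ^ 2) * b y i) x e =
      fderiv ℝ (fun y : EuclideanSpace ℝ (Fin 3) => y 0 ^ 2 + y 1 ^ 2) x e * b x i +
        (x 0 ^ 2 + x 1 ^ 2) * fderiv ℝ b x e i := by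
    intro x
    rw [fderiv_fun_mul (hρd x) (hbid x)]
    simp only [_root_.add_apply, _root_.smul_apply, smul_eq_mul, fderiv_apply_coord_vec3 (hb x) i e]
    ring
  have hDg : ∀ x, fderiv ℝ (fun y => G y ^ 4) x e = 4 * G x ^ 3 * fderiv ℝ G x e :=
    fun x => fderiv_pow_four_apply (hG x) e
  have hibp := integral_mul_fderiv_eq_neg_fderiv_mul_of_integrable (μ := volume)
    (f := fun x : EuclideanSpace ℝ (Fin 3) => (x 0 ^ 2 + x 1 ^ 2) * b x i) (g := fun x => G x ^ 4)
    (v := e) (if'g.congr (Eventually.of_forall fun x => by simp only [hDf x]))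
    (ifg'.congr (Eventually.of_forall fun x => by simp only [hDg x]))
    ifg (fun x _ => hf x) (fun x _ => hg x)
  simp only [hDf, hDg] at hibp
  exact hibp

/-- **Diffusion by parts, per coordinate**: `∫ r² G³ ∂ᵢ∂ᵢG = −∫ (∂ᵢ(r²) G³ + 3 r² G² ∂ᵢG) ∂ᵢG`
(`G ∈ C²`; the three products integrable). [folklore] -/
theorem integral_horizSq_mul_cube_mul_fderiv_fderiv (hG : ContDiff ℝ 2 G) (i : Fin 3)
    (ifg : Integrable (fun x : EuclideanSpace ℝ (Fin 3) => (x 0 ^ 2 + x 1 ^ 2) * G x ^ 3 *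
      fderiv ℝ G x (EuclideanSpace.single i 1)) volume)
    (ifg' : Integrable (fun x : EuclideanSpace ℝ (Fin 3) => (x 0 ^ 2 + x 1 ^ 2) * G x ^ 3 *
      fderiv ℝ (fun y => fderiv ℝ G y (EuclideanSpace.single i 1)) x (EuclideanSpace.single i 1)) volume)
    (if'g : Integrable (fun x : EuclideanSpace ℝ (Fin 3) =>
      (fderiv ℝ (fun y : EuclideanSpace ℝ (Fin 3) => y 0 ^ 2 + y 1 ^ 2) x (EuclideanSpace.single i 1) * G x ^ 3 +
        (x 0 ^ 2 + x 1 ^ 2) * (3 * G x ^ 2 * fderiv ℝ G x (EuclideanSpace.single i 1))) *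
        fderiv ℝ G x (EuclideanSpace.single i 1)) volume) :
    ∫ x : EuclideanSpace ℝ (Fin 3), (x 0 ^ 2 + x 1 ^ 2) * G x ^ 3 *
        fderiv ℝ (fun y => fderiv ℝ G y (EuclideanSpace.single i 1)) x (EuclideanSpace.single i 1) =
      -∫ x : EuclideanSpace ℝ (Fin 3),
        (fderiv ℝ (fun y : EuclideanSpace ℝ (Fin 3) => y 0 ^ 2 + y 1 ^ 2) x (EuclideanSpace.single i 1) * G x ^ 3 +
          (x 0 ^ 2 + x 1 ^ 2) * (3 * G x ^ 2 * fderiv ℝ G x (EuclideanSpace.single i 1))) *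
          fderiv ℝ G x (EuclideanSpace.single i 1) := by
  set e : EuclideanSpace ℝ (Fin 3) := EuclideanSpace.single i 1 with he
  have hGd : Differentiable ℝ G := hG.differentiable (by norm_num)
  have hρd : Differentiable ℝ fun y : EuclideanSpace ℝ (Fin 3) => y 0 ^ 2 + y 1 ^ 2 :=
    fun y => (hasFDerivAt_rho y).differentiableAt
  have hG3 : Differentiable ℝ fun x => G x ^ 3 := hGd.pow 3
  have hf : Differentiable ℝ fun x : EuclideanSpace ℝ (Fin 3) => (x 0 ^ 2 + x 1 ^ 2) * G x ^ 3 :=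
    hρd.mul hG3
  have hg1 : ContDiff ℝ 1 fun y => fderiv ℝ G y e :=
    contDiff_fderiv_apply_const_succ (n := 1) (by exact_mod_cast hG) e
  have hg : Differentiable ℝ fun y => fderiv ℝ G y e := hg1.differentiable one_ne_zero
  have hDf : ∀ x, fderiv ℝ (fun y : EuclideanSpace ℝ (Fin 3) => (y 0 ^ 2 + y 1 ^ 2) * G y ^ 3) x e =
      fderiv ℝ (fun y : EuclideanSpace ℝ (Fin 3) => y 0 ^ 2 + y 1 ^ 2) x e * G x ^ 3 +
        (x 0 ^ 2 + x 1 ^ 2) * (3 * G x ^ 2 * fderiv ℝ G x e) := by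
    intro x
    rw [fderiv_fun_mul (hρd x) (hG3 x)]
    simp only [_root_.add_apply, _root_.smul_apply, smul_eq_mul, fderiv_pow_three_apply (hGd x) e]
    ring
  have hibp := integral_mul_fderiv_eq_neg_fderiv_mul_of_integrable (μ := volume)
    (f := fun x : EuclideanSpace ℝ (Fin 3) => (x 0 ^ 2 + x 1 ^ 2) * G x ^ 3)
    (g := fun y => fderiv ℝ G y e) (v := e)
    (if'g.congr (Eventually.of_forall fun x => by simp only [hDf x])) ifg' ifg
    (fun x _ => hf x) (fun x _ => hg x)
  simp only [hDf] at hibp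
  exact hibp

end IBP

/-! ### Small integration helpers (lambda-typed sums) -/

section Helpers

variable {f g h k : EuclideanSpace ℝ (Fin 3) → ℝ}

/-- `f + g + h` is integrable (lambda form). [folklore] -/
theorem integrable_add_three (hf : Integrable f volume) (hg : Integrable g volume)
    (hh : Integrable h volume) : Integrable (fun x => f x + g x + h x) volume :=
  (hf.add hg).add hh

/-- `∫ (f + g + h) = ∫f + ∫g + ∫h` (lambda form). [folklore] -/
theorem integral_add_three (hf : Integrable f volume) (hg : Integrable g volume)
    (hh : Integrable h volume) :
    ∫ x, f x + g x + h x = (∫ x, f x) + (∫ x, g x) + ∫ x, h x := by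
  have h1 : (fun x => f x + g x + h x) = (f + g) + h := rfl
  rw [h1, integral_add' (hf.add hg) hh, integral_add' hf hg]

/-- `∫ (f + g − h − k) = ∫f + ∫g − ∫h − ∫k` (lambda form). [folklore] -/
theorem integral_add_sub_sub (hf : Integrable f volume) (hg : Integrable g volume)
    (hh : Integrable h volume) (hk : Integrable k volume) :
    ∫ x, f x + g x - h x - k x = (∫ x, f x) + (∫ x, g x) - (∫ x, h x) - ∫ x, k x := by
  have h1 : (fun x => f x + g x - h x - k x) = (f + g) - h - k := rfl
  rw [h1, integral_sub' ((hf.add hg).sub hh) hk, integral_sub' (hf.add hg) hh, integral_add' hf hg]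

end Helpers

/-! ### The identity `∫ r² G³ G' = −3ν ∫ r² G² |∇G|² − (3/2) ∫ r² W G⁴` -/

section PhiFour

variable {G G' W : EuclideanSpace ℝ (Fin 3) → ℝ} {b : EuclideanSpace ℝ (Fin 3) → EuclideanSpace ℝ (Fin 3)}
  {ν : ℝ}

/-- **The `L⁴`-energy identity of `V = v^θ/√r` in the variable `Φ = v^θ/r`** (the computation
behind Lei–Zhang 2017, (7-2)).  Let `G ∈ C²` be an axisymmetric scalar with
`G' + DG[b] = ν (ΔG + 2 radDerivQuot G) − 2 W G` pointwise on `ℝ³`, where `b ∈ C¹` is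
divergence free, bounded with bounded derivative and `x₀b₀ + x₁b₁ = r² W` (`W = bʳ/r`), `W` continuous, `G, ∂ᵢG, ∂ᵢ∂ᵢG, G' ∈ L²`, and `G`, `r²G²`, `W` bounded.  Then
`∫ r² G³ G' = −3ν ∫ r² G² |∇G|² − (3/2) ∫ r² W G⁴` (`r² = x₀² + x₁²`): pairing the equation
with `r²G³`, the transport term is `−∫ r²G³DG[b] = ½ ∫ r² W G⁴` (by parts, `D(r²)[b] = 2r²W`,
`div b = 0`), `ν ∫ r²G³ΔG = −3ν∫ r²G²|∇G|² − 2ν ∫ G³ DG[x_h]` (by parts) and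
`2ν ∫ r²G³ radDerivQuot G = 2ν ∫ G³ DG[x_h]` (`r² radDerivQuot G = DG[x_h]`), so the axis-type
boundary terms cancel. [cite: LeiZhang2017, §4 (7-2) (p. 10)] -/
theorem integral_horizSq_mul_cube_mul_eq_of_phi_eq (hG : ContDiff ℝ 2 G) (hax : IsAxisymmetricScalar G)
    (hb : ContDiff ℝ 1 b) (hdiv : VectorCalculus.IsDivFree b) (hWc : Continuous W)
    (h0 : MemLp G 2 volume)
    (h1 : ∀ i : Fin 3, MemLp (fun x => fderiv ℝ G x (EuclideanSpace.single i 1)) 2 volume)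
    (h2 : ∀ i : Fin 3, MemLp (fun x => fderiv ℝ (fun y => fderiv ℝ G y (EuclideanSpace.single i 1)) x
      (EuclideanSpace.single i 1)) 2 volume)
    (hG' : MemLp G' 2 volume)
    {BG : ℝ} (hGB : ∀ x, |G x| ≤ BG) {B₂ : ℝ} (hB₂ : ∀ x, (x 0 ^ 2 + x 1 ^ 2) * G x ^ 2 ≤ B₂)
    {B : ℝ} (hbB : ∀ x, ‖b x‖ ≤ B) {B' : ℝ} (hDb : ∀ x, ‖fderiv ℝ b x‖ ≤ B')
    {BW : ℝ} (hWB : ∀ x, |W x| ≤ BW)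
    (hW : ∀ x, x 0 * b x 0 + x 1 * b x 1 = (x 0 ^ 2 + x 1 ^ 2) * W x)
    (heq : ∀ x, G' x + fderiv ℝ G x (b x) = ν * ((Δ G) x + 2 * radDerivQuot G x) - 2 * W x * G x) :
    ∫ x, (x 0 ^ 2 + x 1 ^ 2) * G x ^ 3 * G' x =
      -3 * ν * (∫ x, (x 0 ^ 2 + x 1 ^ 2) * G x ^ 2 *
          (fderiv ℝ G x (EuclideanSpace.single 0 1) ^ 2 + fderiv ℝ G x (EuclideanSpace.single 1 1) ^ 2 +
            fderiv ℝ G x (EuclideanSpace.single 2 1) ^ 2))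
        - 3 / 2 * ∫ x, (x 0 ^ 2 + x 1 ^ 2) * W x * G x ^ 4 := by
  -- abbreviations
  set e : Fin 3 → EuclideanSpace ℝ (Fin 3) := fun i => EuclideanSpace.single i 1 with he
  have he' : ∀ i, EuclideanSpace.single i (1 : ℝ) = e i := fun i => rfl
  simp only [he'] at h1 h2 ⊢
  set ρ : EuclideanSpace ℝ (Fin 3) → ℝ := fun y => y 0 ^ 2 + y 1 ^ 2 with hρ
  have hρ' : ∀ x : EuclideanSpace ℝ (Fin 3), x 0 ^ 2 + x 1 ^ 2 = ρ x := fun x => rfl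
  simp only [hρ'] at hB₂ hW ⊢
  -- regularity
  have hGd : Differentiable ℝ G := hG.differentiable (by norm_num)
  have hbd : Differentiable ℝ b := hb.differentiable one_ne_zero
  have cG : Continuous G := hG.continuous
  have cρ : Continuous ρ := (contDiff_horizSq (n := 0)).continuous
  have cb : ∀ i, Continuous fun x => b x i := fun i => (contDiff_apply_coord_vec3 hb i).continuous
  have cDb : ∀ v i, Continuous fun x => fderiv ℝ b x v i := fun v i =>
    (contDiff_apply_coord_vec3 (contDiff_zero.2 ((hb.continuous_fderiv one_ne_zero).clm_apply
      continuous_const)) i).continuous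
  have cxG : ∀ i : Fin 3, Continuous fun x : EuclideanSpace ℝ (Fin 3) => x i * G x := fun i =>
    (contDiff_piLp_apply (𝕜 := ℝ) (p := 2) (n := 0) (i := i)).continuous.mul cG
  have cP : Continuous fun x => ρ x * G x ^ 2 := cρ.mul (cG.pow 2)
  -- pointwise formulas
  have hρ0 : ∀ x, fderiv ℝ ρ x (e 0) = 2 * x 0 := fun x => by
    rw [hρ, fderiv_rho_apply]; simp [he]
  have hρ1 : ∀ x, fderiv ℝ ρ x (e 1) = 2 * x 1 := fun x => by
    rw [hρ, fderiv_rho_apply]; simp [he]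
  have hρ2 : ∀ x, fderiv ℝ ρ x (e 2) = 0 := fun x => by
    rw [hρ, fderiv_rho_apply]; simp [he]
  have hdivx : ∀ x, fderiv ℝ b x (e 0) 0 + fderiv ℝ b x (e 1) 1 + fderiv ℝ b x (e 2) 2 = 0 := by
    intro x
    have h := hdiv x
    rw [divergence_eq_sum_three] at h
    exact h
  have hDGb : ∀ x, fderiv ℝ G x (b x) = b x 0 * fderiv ℝ G x (e 0) + b x 1 * fderiv ℝ G x (e 1) +
      b x 2 * fderiv ℝ G x (e 2) := fun x => fderiv_apply_eq_sum_three G x (b x)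
  have hρq : ∀ x, ρ x * radDerivQuot G x = x 0 * fderiv ℝ G x (e 0) + x 1 * fderiv ℝ G x (e 1) := by
    intro x
    have h := fderiv_apply_horizontal_eq hG hax x
    rw [map_add, map_smul, map_smul, smul_eq_mul, smul_eq_mul, cylRadius_sq] at h
    rw [← h]
  have hlap : ∀ x, (Δ G) x = fderiv ℝ (fun y => fderiv ℝ G y (e 0)) x (e 0) +
      fderiv ℝ (fun y => fderiv ℝ G y (e 1)) x (e 1) + fderiv ℝ (fun y => fderiv ℝ G y (e 2)) x (e 2) := by
    intro x
    rw [laplacian_eq_sum_fderiv_fderiv (EuclideanSpace.basisFun (Fin 3) ℝ) hG x]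
    simp only [EuclideanSpace.basisFun_apply, Fin.sum_univ_three, he]
  -- bounds on the bounded factors
  have bP : ∀ x, ‖ρ x * G x ^ 2‖ ≤ B₂ := fun x => by
    rw [Real.norm_of_nonneg (by positivity)]; exact hB₂ x
  have bG : ∀ x, ‖G x‖ ≤ BG := fun x => by rw [Real.norm_eq_abs]; exact hGB x
  have bb : ∀ i x, ‖b x i‖ ≤ B := fun i x => (PiLp.norm_apply_le (b x) i).trans (hbB x)
  have bDb : ∀ i x, ‖fderiv ℝ b x (e i) i‖ ≤ B' := fun i x => by
    calc ‖fderiv ℝ b x (e i) i‖ ≤ ‖fderiv ℝ b x (e i)‖ := PiLp.norm_apply_le _ i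
      _ ≤ ‖fderiv ℝ b x‖ * ‖e i‖ := (fderiv ℝ b x).le_opNorm (e i)
      _ = ‖fderiv ℝ b x‖ := by simp [he]
      _ ≤ B' := hDb x
  have bW : ∀ x, ‖W x‖ ≤ BW := fun x => by rw [Real.norm_eq_abs]; exact hWB x
  have bxG : ∀ i : Fin 3, i = 0 ∨ i = 1 → ∀ x, ‖x i * G x‖ ≤ Real.sqrt B₂ := by
    intro i hi x
    rw [Real.norm_eq_abs]
    refine Real.abs_le_sqrt ?_
    have hx : x i ^ 2 ≤ ρ x := by
      rcases hi with rfl | rfl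
      · show x 0 ^ 2 ≤ x 0 ^ 2 + x 1 ^ 2; nlinarith [sq_nonneg (x 1)]
      · show x 1 ^ 2 ≤ x 0 ^ 2 + x 1 ^ 2; nlinarith [sq_nonneg (x 0)]
    calc (x i * G x) ^ 2 = x i ^ 2 * G x ^ 2 := by ring
      _ ≤ ρ x * G x ^ 2 := mul_le_mul_of_nonneg_right hx (sq_nonneg _)
      _ ≤ B₂ := hB₂ x
  -- a multiplier lemma
  have key : ∀ {f g : EuclideanSpace ℝ (Fin 3) → ℝ} {C : ℝ}, Continuous f → (∀ x, ‖f x‖ ≤ C) →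
      Integrable g volume → Integrable (fun x => f x * g x) volume :=
    fun hf hC hg => hg.bdd_mul hf.aestronglyMeasurable (ae_of_all _ hC)
  -- base integrable products
  have iGG' : Integrable (fun x => G x * G' x) volume := h0.integrable_mul hG'
  have iGG : Integrable (fun x => G x * G x) volume := h0.integrable_mul h0
  have iGD : ∀ i, Integrable (fun x => G x * fderiv ℝ G x (e i)) volume := fun i => h0.integrable_mul (h1 i)
  have iGDD : ∀ i, Integrable (fun x => G x * fderiv ℝ (fun y => fderiv ℝ G y (e i)) x (e i)) volume :=
    fun i => h0.integrable_mul (h2 i)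
  have iDD : ∀ i, Integrable (fun x => fderiv ℝ G x (e i) * fderiv ℝ G x (e i)) volume :=
    fun i => (h1 i).integrable_mul (h1 i)
  -- the integrands
  have iI : Integrable (fun x => ρ x * G x ^ 3 * G' x) volume :=
    (key cP bP iGG').congr (ae_of_all _ fun x => by simp only; ring)
  have iT : ∀ i, Integrable (fun x => ρ x * b x i * (G x ^ 3 * fderiv ℝ G x (e i))) volume := by
    intro i
    exact (key cP bP (key (cb i) (bb i) (iGD i))).congr (ae_of_all _ fun x => by simp only; ring)
  have iW : Integrable (fun x => ρ x * W x * G x ^ 4) volume :=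
    (key cP bP (key hWc bW iGG)).congr (ae_of_all _ fun x => by simp only; ring)
  have iL : ∀ i, Integrable (fun x => ρ x * G x ^ 3 *
      fderiv ℝ (fun y => fderiv ℝ G y (e i)) x (e i)) volume := fun i =>
    (key cP bP (iGDD i)).congr (ae_of_all _ fun x => by simp only; ring)
  have iX : ∀ i : Fin 3, i = 0 ∨ i = 1 →
      Integrable (fun x => x i * G x ^ 3 * fderiv ℝ G x (e i)) volume := by
    intro i hi
    exact (key (cxG i) (bxG i hi) (key cG bG (iGD i))).congr
      (ae_of_all _ fun x => by simp only; ring)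
  have iD : ∀ i, Integrable (fun x => ρ x * G x ^ 2 * fderiv ℝ G x (e i) ^ 2) volume := fun i =>
    (key cP bP (iDD i)).congr (ae_of_all _ fun x => by simp only; ring)
  have iF1 : ∀ i, Integrable (fun x => ρ x * b x i * G x ^ 4) volume := fun i =>
    (key cP bP (key (cb i) (bb i) iGG)).congr (ae_of_all _ fun x => by simp only; ring)
  have iρDb : ∀ i, Integrable (fun x => ρ x * fderiv ℝ b x (e i) i * G x ^ 4) volume := fun i =>
    (key cP bP (key (cDb (e i) i) (bDb i) iGG)).congr (ae_of_all _ fun x => by simp only; ring)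
  have ixbG4 : ∀ i : Fin 3, i = 0 ∨ i = 1 → Integrable (fun x => x i * b x i * G x ^ 4) volume := by
    intro i hi
    exact (key (cxG i) (bxG i hi) (key (cb i) (bb i) (key cG bG iGG))).congr
      (ae_of_all _ fun x => by simp only; ring)
  have iF2 : ∀ i, Integrable (fun x => (fderiv ℝ ρ x (e i) * b x i + ρ x * fderiv ℝ b x (e i) i) * G x ^ 4)
      volume := by
    intro i
    match i with
    | 0 =>
      refine (((ixbG4 0 (Or.inl rfl)).const_mul 2).add (iρDb 0)).congr (ae_of_all _ fun x => ?_)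
      simp only [hρ0, Pi.add_apply]; ring
    | 1 =>
      refine (((ixbG4 1 (Or.inr rfl)).const_mul 2).add (iρDb 1)).congr (ae_of_all _ fun x => ?_)
      simp only [hρ1, Pi.add_apply]; ring
    | 2 =>
      refine (iρDb 2).congr (ae_of_all _ fun x => ?_)
      simp only [hρ2]; ring
  have iF3 : ∀ i, Integrable (fun x => ρ x * G x ^ 3 * fderiv ℝ G x (e i)) volume := fun i =>
    (key cP bP (iGD i)).congr (ae_of_all _ fun x => by simp only; ring)
  have iF4 : ∀ i, Integrable (fun x => (fderiv ℝ ρ x (e i) * G x ^ 3 +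
      ρ x * (3 * G x ^ 2 * fderiv ℝ G x (e i))) * fderiv ℝ G x (e i)) volume := by
    intro i
    match i with
    | 0 =>
      refine (((iX 0 (Or.inl rfl)).const_mul 2).add ((iD 0).const_mul 3)).congr
        (ae_of_all _ fun x => ?_)
      simp only [hρ0, Pi.add_apply]; ring
    | 1 =>
      refine (((iX 1 (Or.inr rfl)).const_mul 2).add ((iD 1).const_mul 3)).congr
        (ae_of_all _ fun x => ?_)
      simp only [hρ1, Pi.add_apply]; ring
    | 2 =>
      refine ((iD 2).const_mul 3).congr (ae_of_all _ fun x => ?_)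
      simp only [hρ2]; ring
  have iXf : Integrable (fun x => G x ^ 3 * (x 0 * fderiv ℝ G x (e 0) + x 1 * fderiv ℝ G x (e 1))) volume :=
    ((iX 0 (Or.inl rfl)).add (iX 1 (Or.inr rfl))).congr (ae_of_all _ fun x => by
      simp only [Pi.add_apply]; ring)
  have iDf : Integrable (fun x => ρ x * G x ^ 2 * (fderiv ℝ G x (e 0) ^ 2 + fderiv ℝ G x (e 1) ^ 2 +
      fderiv ℝ G x (e 2) ^ 2)) volume :=
    (((iD 0).add (iD 1)).add (iD 2)).congr (ae_of_all _ fun x => by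
      simp only [Pi.add_apply]; ring)
  -- the two integrations by parts, per coordinate
  have ibp1 : ∀ i, 4 * ∫ x, ρ x * b x i * (G x ^ 3 * fderiv ℝ G x (e i)) =
      -∫ x, (fderiv ℝ ρ x (e i) * b x i + ρ x * fderiv ℝ b x (e i) i) * G x ^ 4 := by
    intro i
    have h := integral_horizSq_mul_coord_mul_fderiv_pow_four hGd hbd i (iF1 i)
      (((iT i).const_mul 4).congr (ae_of_all _ fun x => by simp only; ring)) (iF2 i)
    simp only [he', hρ'] at h
    rw [← h, ← integral_const_mul]
    exact integral_congr_ae (ae_of_all _ fun x => by simp only; ring)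
  have ibp2 : ∀ i, ∫ x, ρ x * G x ^ 3 * fderiv ℝ (fun y => fderiv ℝ G y (e i)) x (e i) =
      -∫ x, (fderiv ℝ ρ x (e i) * G x ^ 3 + ρ x * (3 * G x ^ 2 * fderiv ℝ G x (e i))) *
        fderiv ℝ G x (e i) := by
    intro i
    have h := integral_horizSq_mul_cube_mul_fderiv_fderiv hG i (iF3 i) (iL i) (iF4 i)
    simp only [he', hρ'] at h
    exact h
  -- names for the integrals
  set T : Fin 3 → ℝ := fun i => ∫ x, ρ x * b x i * (G x ^ 3 * fderiv ℝ G x (e i)) with hT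
  set L : Fin 3 → ℝ := fun i => ∫ x, ρ x * G x ^ 3 * fderiv ℝ (fun y => fderiv ℝ G y (e i)) x (e i)
    with hL
  set X : ℝ := ∫ x, G x ^ 3 * (x 0 * fderiv ℝ G x (e 0) + x 1 * fderiv ℝ G x (e 1)) with hX
  set Dt : ℝ := ∫ x, ρ x * G x ^ 2 * (fderiv ℝ G x (e 0) ^ 2 + fderiv ℝ G x (e 1) ^ 2 +
    fderiv ℝ G x (e 2) ^ 2) with hDt
  set Wt : ℝ := ∫ x, ρ x * W x * G x ^ 4 with hWt
  -- sum of the transport integrations by parts: `4 Σ Tᵢ = −2 Wt`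
  have hTsum : 4 * (T 0 + T 1 + T 2) = -2 * Wt := by
    have hpt : ∀ x, (fderiv ℝ ρ x (e 0) * b x 0 + ρ x * fderiv ℝ b x (e 0) 0) * G x ^ 4 +
        (fderiv ℝ ρ x (e 1) * b x 1 + ρ x * fderiv ℝ b x (e 1) 1) * G x ^ 4 +
        (fderiv ℝ ρ x (e 2) * b x 2 + ρ x * fderiv ℝ b x (e 2) 2) * G x ^ 4 =
        2 * (ρ x * W x * G x ^ 4) := by
      intro x
      rw [hρ0, hρ1, hρ2]
      have h1 := hW x
      have h2 := hdivx x
      have h3 : ρ x * (fderiv ℝ b x (e 0) 0 + fderiv ℝ b x (e 1) 1 + fderiv ℝ b x (e 2) 2) * G x ^ 4 = 0 := by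
        rw [h2]; ring
      linear_combination (2 * G x ^ 4) * h1 + h3
    have hsum := integral_congr_ae (μ := volume) (ae_of_all _ hpt)
    rw [integral_add_three (iF2 0) (iF2 1) (iF2 2), integral_const_mul] at hsum
    have e0 := ibp1 0
    have e1 := ibp1 1
    have e2 := ibp1 2
    simp only [hT, hWt]
    linarith
  -- sum of the diffusion integrations by parts: `Σ Lᵢ = −2X − 3 Dt`
  have hLsum : L 0 + L 1 + L 2 = -2 * X - 3 * Dt := by
    have hpt : ∀ x, (fderiv ℝ ρ x (e 0) * G x ^ 3 + ρ x * (3 * G x ^ 2 * fderiv ℝ G x (e 0))) *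
          fderiv ℝ G x (e 0) +
        (fderiv ℝ ρ x (e 1) * G x ^ 3 + ρ x * (3 * G x ^ 2 * fderiv ℝ G x (e 1))) *
          fderiv ℝ G x (e 1) +
        (fderiv ℝ ρ x (e 2) * G x ^ 3 + ρ x * (3 * G x ^ 2 * fderiv ℝ G x (e 2))) *
          fderiv ℝ G x (e 2) =
        2 * (G x ^ 3 * (x 0 * fderiv ℝ G x (e 0) + x 1 * fderiv ℝ G x (e 1))) +
          3 * (ρ x * G x ^ 2 * (fderiv ℝ G x (e 0) ^ 2 + fderiv ℝ G x (e 1) ^ 2 +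
            fderiv ℝ G x (e 2) ^ 2)) := by
      intro x
      rw [hρ0, hρ1, hρ2]
      ring
    have hsum := integral_congr_ae (μ := volume) (ae_of_all _ hpt)
    rw [integral_add_three (iF4 0) (iF4 1) (iF4 2), integral_add (iXf.const_mul 2) (iDf.const_mul 3),
      integral_const_mul, integral_const_mul] at hsum
    have e0 := ibp2 0
    have e1 := ibp2 1
    have e2 := ibp2 2
    simp only [hL, hX, hDt]
    linarith
  -- integrate the pointwise equation against `ρ G³`
  have hmain : (∫ x, ρ x * G x ^ 3 * G' x) =
      ν * (L 0 + L 1 + L 2) + 2 * ν * X - 2 * Wt - (T 0 + T 1 + T 2) := by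
    have hpt : ∀ x, ρ x * G x ^ 3 * G' x =
        ν * (ρ x * G x ^ 3 * fderiv ℝ (fun y => fderiv ℝ G y (e 0)) x (e 0) +
            ρ x * G x ^ 3 * fderiv ℝ (fun y => fderiv ℝ G y (e 1)) x (e 1) +
            ρ x * G x ^ 3 * fderiv ℝ (fun y => fderiv ℝ G y (e 2)) x (e 2)) +
          2 * ν * (G x ^ 3 * (x 0 * fderiv ℝ G x (e 0) + x 1 * fderiv ℝ G x (e 1))) -
          2 * (ρ x * W x * G x ^ 4) -
          (ρ x * b x 0 * (G x ^ 3 * fderiv ℝ G x (e 0)) + ρ x * b x 1 * (G x ^ 3 * fderiv ℝ G x (e 1)) +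
            ρ x * b x 2 * (G x ^ 3 * fderiv ℝ G x (e 2))) := by
      intro x
      have h := heq x
      rw [hDGb x, hlap x] at h
      have hq := hρq x
      have hρG3q : ρ x * G x ^ 3 * (2 * radDerivQuot G x) =
          2 * (G x ^ 3 * (x 0 * fderiv ℝ G x (e 0) + x 1 * fderiv ℝ G x (e 1))) := by
        rw [← hq]; ring
      linear_combination (ρ x * G x ^ 3) * h + ν * hρG3q
    have iLs : Integrable (fun x => ν * (ρ x * G x ^ 3 * fderiv ℝ (fun y => fderiv ℝ G y (e 0)) x (e 0) +
        ρ x * G x ^ 3 * fderiv ℝ (fun y => fderiv ℝ G y (e 1)) x (e 1) +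
        ρ x * G x ^ 3 * fderiv ℝ (fun y => fderiv ℝ G y (e 2)) x (e 2))) volume :=
      (integrable_add_three (iL 0) (iL 1) (iL 2)).const_mul ν
    have iTs : Integrable (fun x => ρ x * b x 0 * (G x ^ 3 * fderiv ℝ G x (e 0)) +
        ρ x * b x 1 * (G x ^ 3 * fderiv ℝ G x (e 1)) + ρ x * b x 2 * (G x ^ 3 * fderiv ℝ G x (e 2))) volume :=
      integrable_add_three (iT 0) (iT 1) (iT 2)
    have hsum := integral_congr_ae (μ := volume) (ae_of_all _ hpt)
    rw [integral_add_sub_sub iLs (iXf.const_mul _) (iW.const_mul 2) iTs, integral_const_mul,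
      integral_const_mul, integral_const_mul, integral_add_three (iL 0) (iL 1) (iL 2),
      integral_add_three (iT 0) (iT 1) (iT 2)] at hsum
    simp only [hT, hL, hX, hWt]
    linarith
  -- conclude
  have hfinal : (∫ x, ρ x * G x ^ 3 * G' x) = -3 * ν * Dt - 3 / 2 * Wt := by
    have hT' : T 0 + T 1 + T 2 = -(1 / 2) * Wt := by linarith
    rw [hmain, hLsum, hT']
    ring
  rw [hfinal, hDt]


/-! ### The Hardy-type bound `∫ G⁴ ≤ 4 ∫ r² G² |∇ₕG|²` -/

/-- **`‖r⁻¹V²‖²_{L²} ≤ 4 ∫ r² Φ² |∇ₕΦ|²`** in the variable `G = Φ` (the smooth form of the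
absorption `‖r⁻¹|V|²‖² ≤ ‖∇|V|²‖² + ‖r⁻¹|V|²‖²` used in (7-1)–(7-2)): for `G ∈ C¹` with
`G, ∂ᵢG ∈ L²` and `G`, `r²G²` bounded,
`∫ G⁴ ≤ 4 ∫ (x₀² + x₁²) G² ((∂₀G)² + (∂₁G)²)`.  Proof: `2 ∫ G⁴ = −Σ_{i<2} ∫ xᵢ ∂ᵢ(G⁴) =
−4 ∫ G³ (x₀∂₀G + x₁∂₁G) ≤ 4 (∫G⁴)^{1/2} (∫ r² G² |∇ₕG|²)^{1/2}` (by parts and Cauchy–Schwarz).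
[cite: LeiZhang2017, §4 (7-2) (p. 10)] -/
theorem integral_pow_four_le_four_mul (hG : ContDiff ℝ 1 G) (h0 : MemLp G 2 volume)
    (h1 : ∀ i : Fin 3, MemLp (fun x => fderiv ℝ G x (EuclideanSpace.single i 1)) 2 volume)
    {BG : ℝ} (hGB : ∀ x, |G x| ≤ BG) {B₂ : ℝ} (hB₂ : ∀ x, (x 0 ^ 2 + x 1 ^ 2) * G x ^ 2 ≤ B₂) :
    ∫ x, G x ^ 4 ≤ 4 * ∫ x, (x 0 ^ 2 + x 1 ^ 2) * G x ^ 2 *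
      (fderiv ℝ G x (EuclideanSpace.single 0 1) ^ 2 + fderiv ℝ G x (EuclideanSpace.single 1 1) ^ 2) := by
  set e : Fin 3 → EuclideanSpace ℝ (Fin 3) := fun i => EuclideanSpace.single i 1 with he
  have he' : ∀ i, EuclideanSpace.single i (1 : ℝ) = e i := fun i => rfl
  simp only [he'] at h1 ⊢
  have hGd : Differentiable ℝ G := hG.differentiable one_ne_zero
  have cG : Continuous G := hG.continuous
  have cDG : ∀ v, Continuous fun x => fderiv ℝ G x v := fun v =>
    (hG.continuous_fderiv one_ne_zero).clm_apply continuous_const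
  have cx : ∀ i : Fin 3, Continuous fun x : EuclideanSpace ℝ (Fin 3) => x i := fun i =>
    (contDiff_piLp_apply (𝕜 := ℝ) (p := 2) (n := 0) (i := i)).continuous
  have cxG : ∀ i : Fin 3, Continuous fun x : EuclideanSpace ℝ (Fin 3) => x i * G x := fun i => (cx i).mul cG
  have cG2 : Continuous fun x => G x ^ 2 := cG.pow 2
  -- bounds
  have hB₂0 : 0 ≤ B₂ := le_trans (by positivity) (hB₂ 0)
  have bG : ∀ x, ‖G x‖ ≤ BG := fun x => by rw [Real.norm_eq_abs]; exact hGB x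
  have bGG : ∀ x, ‖G x ^ 2‖ ≤ BG ^ 2 := fun x => by
    rw [Real.norm_eq_abs, abs_pow]; exact pow_le_pow_left₀ (abs_nonneg _) (hGB x) 2
  have bxG : ∀ i : Fin 3, i = 0 ∨ i = 1 → ∀ x, ‖x i * G x‖ ≤ Real.sqrt B₂ := by
    intro i hi x
    rw [Real.norm_eq_abs]
    refine Real.abs_le_sqrt ?_
    have hx : x i ^ 2 ≤ x 0 ^ 2 + x 1 ^ 2 := by
      rcases hi with rfl | rfl
      · nlinarith [sq_nonneg (x 1)]
      · nlinarith [sq_nonneg (x 0)]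
    calc (x i * G x) ^ 2 = x i ^ 2 * G x ^ 2 := by ring
      _ ≤ (x 0 ^ 2 + x 1 ^ 2) * G x ^ 2 := mul_le_mul_of_nonneg_right hx (sq_nonneg _)
      _ ≤ B₂ := hB₂ x
  have key : ∀ {f g : EuclideanSpace ℝ (Fin 3) → ℝ} {C : ℝ}, Continuous f → (∀ x, ‖f x‖ ≤ C) →
      Integrable g volume → Integrable (fun x => f x * g x) volume :=
    fun hf hC hg => hg.bdd_mul hf.aestronglyMeasurable (ae_of_all _ hC)
  -- integrable pieces
  have iGG : Integrable (fun x => G x * G x) volume := h0.integrable_mul h0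
  have iGD : ∀ i, Integrable (fun x => G x * fderiv ℝ G x (e i)) volume := fun i => h0.integrable_mul (h1 i)
  have iDD : ∀ i, Integrable (fun x => fderiv ℝ G x (e i) * fderiv ℝ G x (e i)) volume :=
    fun i => (h1 i).integrable_mul (h1 i)
  have iA : Integrable (fun x => G x ^ 4) volume :=
    (key cG2 bGG iGG).congr (ae_of_all _ fun x => by simp only; ring)
  have iX : ∀ i : Fin 3, i = 0 ∨ i = 1 →
      Integrable (fun x => x i * (4 * G x ^ 3 * fderiv ℝ G x (e i))) volume := by
    intro i hi
    exact (key (cxG i) (bxG i hi) (key cG bG ((iGD i).const_mul 4))).congr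
      (ae_of_all _ fun x => by simp only; ring)
  have ixG4 : ∀ i : Fin 3, i = 0 ∨ i = 1 → Integrable (fun x => x i * G x ^ 4) volume := by
    intro i hi
    exact (key (cxG i) (bxG i hi) (key cG bG iGG)).congr (ae_of_all _ fun x => by simp only; ring)
  -- by parts: `∫ xᵢ ∂ᵢ(G⁴) = −∫ G⁴`
  have ibp : ∀ i : Fin 3, i = 0 ∨ i = 1 →
      ∫ x, x i * (4 * G x ^ 3 * fderiv ℝ G x (e i)) = -∫ x, G x ^ 4 := by
    intro i hi
    have hxi : ∀ x : EuclideanSpace ℝ (Fin 3), fderiv ℝ (fun y : EuclideanSpace ℝ (Fin 3) => y i) x (e i) = 1 := by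
      intro x
      have hfun : (fun y : EuclideanSpace ℝ (Fin 3) => y i) =
          ⇑(EuclideanSpace.proj (𝕜 := ℝ) i : EuclideanSpace ℝ (Fin 3) →L[ℝ] ℝ) := by
        funext y; simp
      rw [hfun, ((EuclideanSpace.proj (𝕜 := ℝ) i : EuclideanSpace ℝ (Fin 3) →L[ℝ] ℝ).hasFDerivAt).fderiv]
      simp [he]
    have hDg : ∀ x, fderiv ℝ (fun y => G y ^ 4) x (e i) = 4 * G x ^ 3 * fderiv ℝ G x (e i) :=
      fun x => fderiv_pow_four_apply (hGd x) (e i)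
    have h := integral_mul_fderiv_eq_neg_fderiv_mul_of_integrable (μ := volume)
      (f := fun y : EuclideanSpace ℝ (Fin 3) => y i) (g := fun y => G y ^ 4) (v := e i)
      (iA.congr (ae_of_all _ fun x => by simp only [hxi x, one_mul]))
      ((iX i hi).congr (ae_of_all _ fun x => by simp only [hDg x]))
      (ixG4 i hi) (fun x _ => (EuclideanSpace.proj (𝕜 := ℝ) i).differentiableAt)
      (fun x _ => (hGd x).pow 4)
    simp only [hDg, hxi, one_mul] at h
    exact h
  -- `2 ∫ G⁴ = −4 X`, `X = ∫ G³ (x₀∂₀G + x₁∂₁G)`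
  set A : ℝ := ∫ x, G x ^ 4 with hA
  have iXf : Integrable (fun x => G x ^ 2 * (G x * (x 0 * fderiv ℝ G x (e 0) + x 1 * fderiv ℝ G x (e 1))))
      volume := by
    have := ((iX 0 (Or.inl rfl)).add (iX 1 (Or.inr rfl)))
    refine (this.const_mul (1 / 4)).congr (ae_of_all _ fun x => ?_)
    simp only [Pi.add_apply]; ring
  have h2A : 2 * A = -4 * ∫ x, G x ^ 2 * (G x * (x 0 * fderiv ℝ G x (e 0) + x 1 * fderiv ℝ G x (e 1))) := by
    have e0 := ibp 0 (Or.inl rfl)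
    have e1 := ibp 1 (Or.inr rfl)
    have hsum : (∫ x, x 0 * (4 * G x ^ 3 * fderiv ℝ G x (e 0))) + ∫ x, x 1 * (4 * G x ^ 3 * fderiv ℝ G x (e 1)) =
        4 * ∫ x, G x ^ 2 * (G x * (x 0 * fderiv ℝ G x (e 0) + x 1 * fderiv ℝ G x (e 1))) := by
      rw [← integral_add (iX 0 (Or.inl rfl)) (iX 1 (Or.inr rfl)), ← integral_const_mul]
      exact integral_congr_ae (ae_of_all _ fun x => by simp only; ring)
    linarith
  -- Cauchy–Schwarz
  have mG2 : MemLp (fun x => G x ^ 2) 2 volume := by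
    refine (h0.const_mul BG).of_le (cG2.aestronglyMeasurable) (ae_of_all _ fun x => ?_)
    rw [Real.norm_eq_abs, Real.norm_eq_abs, abs_pow, abs_mul, sq]
    have hB0 : 0 ≤ BG := (abs_nonneg _).trans (hGB x)
    rw [abs_of_nonneg hB0]
    exact mul_le_mul_of_nonneg_right (hGB x) (abs_nonneg _)
  have mY : MemLp (fun x => G x * (x 0 * fderiv ℝ G x (e 0) + x 1 * fderiv ℝ G x (e 1))) 2 volume := by
    have m := (((h1 0).norm.add (h1 1).norm).const_mul (Real.sqrt B₂))
    refine m.of_le ?_ (ae_of_all _ fun x => ?_)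
    · exact (cG.mul (((cx 0).mul (cDG _)).add ((cx 1).mul (cDG _)))).aestronglyMeasurable
    · have hs : 0 ≤ Real.sqrt B₂ := Real.sqrt_nonneg _
      rw [Real.norm_eq_abs, Real.norm_eq_abs, Pi.add_apply,
        abs_of_nonneg (by positivity : 0 ≤ Real.sqrt B₂ * (‖fderiv ℝ G x (e 0)‖ + ‖fderiv ℝ G x (e 1)‖)),
        Real.norm_eq_abs, Real.norm_eq_abs]
      have h0' := bxG 0 (Or.inl rfl) x
      have h1' := bxG 1 (Or.inr rfl) x
      rw [Real.norm_eq_abs] at h0' h1'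
      calc |G x * (x 0 * fderiv ℝ G x (e 0) + x 1 * fderiv ℝ G x (e 1))|
          = |x 0 * G x * fderiv ℝ G x (e 0) + x 1 * G x * fderiv ℝ G x (e 1)| := by ring_nf
        _ ≤ |x 0 * G x * fderiv ℝ G x (e 0)| + |x 1 * G x * fderiv ℝ G x (e 1)| := abs_add_le _ _
        _ = |x 0 * G x| * |fderiv ℝ G x (e 0)| + |x 1 * G x| * |fderiv ℝ G x (e 1)| := by
            rw [abs_mul (x 0 * G x), abs_mul (x 1 * G x)]
        _ ≤ Real.sqrt B₂ * |fderiv ℝ G x (e 0)| + Real.sqrt B₂ * |fderiv ℝ G x (e 1)| :=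
            add_le_add (mul_le_mul_of_nonneg_right h0' (abs_nonneg _))
              (mul_le_mul_of_nonneg_right h1' (abs_nonneg _))
        _ = Real.sqrt B₂ * (|fderiv ℝ G x (e 0)| + |fderiv ℝ G x (e 1)|) := by ring
  have hCS := integral_mul_le_sqrt_mul_sqrt_of_memLp mG2 mY.neg
  -- `∫ Y² ≤ Bw`
  set Bw : ℝ := ∫ x, (x 0 ^ 2 + x 1 ^ 2) * G x ^ 2 * (fderiv ℝ G x (e 0) ^ 2 + fderiv ℝ G x (e 1) ^ 2) with hBw
  have iBw : Integrable (fun x => (x 0 ^ 2 + x 1 ^ 2) * G x ^ 2 *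
      (fderiv ℝ G x (e 0) ^ 2 + fderiv ℝ G x (e 1) ^ 2)) volume := by
    have cP : Continuous fun x : EuclideanSpace ℝ (Fin 3) => (x 0 ^ 2 + x 1 ^ 2) * G x ^ 2 :=
      (contDiff_horizSq (n := 0)).continuous.mul (cG.pow 2)
    have bP : ∀ x : EuclideanSpace ℝ (Fin 3), ‖(x 0 ^ 2 + x 1 ^ 2) * G x ^ 2‖ ≤ B₂ := fun x => by
      rw [Real.norm_of_nonneg (by positivity)]; exact hB₂ x
    exact (key cP bP ((iDD 0).add (iDD 1))).congr (ae_of_all _ fun x => by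
      simp only [Pi.add_apply]; ring)
  have hY2 : ∫ x, (-(G x * (x 0 * fderiv ℝ G x (e 0) + x 1 * fderiv ℝ G x (e 1)))) ^ 2 ≤ Bw := by
    refine integral_mono (by simpa using mY.neg.integrable_sq) iBw fun x => ?_
    simp only
    nlinarith [sq_nonneg (x 0 * fderiv ℝ G x (e 1) - x 1 * fderiv ℝ G x (e 0)), sq_nonneg (G x)]
  have hG4 : ∫ x, (G x ^ 2) ^ 2 = A := by
    rw [hA]; exact integral_congr_ae (ae_of_all _ fun x => by simp only; ring)
  rw [hG4] at hCS
  -- assemble: `2A ≤ 4 √A √Bw`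
  have hA0 : 0 ≤ A := integral_nonneg fun x => by positivity
  have hBw0 : 0 ≤ Bw := integral_nonneg fun x => by positivity
  have hX : -(∫ x, G x ^ 2 * (G x * (x 0 * fderiv ℝ G x (e 0) + x 1 * fderiv ℝ G x (e 1)))) ≤
      Real.sqrt A * Real.sqrt Bw := by
    have : ∫ x, G x ^ 2 * -(G x * (x 0 * fderiv ℝ G x (e 0) + x 1 * fderiv ℝ G x (e 1))) =
        -(∫ x, G x ^ 2 * (G x * (x 0 * fderiv ℝ G x (e 0) + x 1 * fderiv ℝ G x (e 1)))) := by
      rw [← integral_neg]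
      exact integral_congr_ae (ae_of_all _ fun x => by simp only; ring)
    rw [← this]
    exact hCS.trans (mul_le_mul_of_nonneg_left (Real.sqrt_le_sqrt hY2) (Real.sqrt_nonneg _))
  have h2A' : 2 * A ≤ 4 * (Real.sqrt A * Real.sqrt Bw) := by linarith
  have hsA := Real.sq_sqrt hA0
  have hsB := Real.sq_sqrt hBw0
  have hfin : A ≤ 4 * Bw := by
    nlinarith [Real.sqrt_nonneg A, Real.sqrt_nonneg Bw,
      sq_nonneg (Real.sqrt A - 2 * Real.sqrt Bw)]
  simpa only [hA, hBw] using hfin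

end PhiFour

/-! ### The identity for a classical axisymmetric Navier–Stokes solution -/

section NS

variable {u : EuclideanSpace ℝ (Fin 3) → EuclideanSpace ℝ (Fin 3)}

/-- `r² Φ² = (u^θ)² ≤ |u|²`: `(x₀² + x₁²) (angVelQuot u x)² ≤ ‖u x‖²` for an axisymmetric `u ∈ C²`
(Lagrange's identity `Γ² + (x₀u₀ + x₁u₁)² = r² (u₀² + u₁²)`). [folklore] -/
theorem IsAxisymmetric.horizSq_mul_angVelQuot_sq_le (hax : IsAxisymmetric u) (hu : ContDiff ℝ 2 u)
    (x : EuclideanSpace ℝ (Fin 3)) :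
    (x 0 ^ 2 + x 1 ^ 2) * angVelQuot u x ^ 2 ≤ ‖u x‖ ^ 2 := by
  have hΓ := hax.cylRadius_sq_mul_angVelQuot hu x
  rw [cylRadius_sq] at hΓ
  have hn : u x 0 ^ 2 + u x 1 ^ 2 ≤ ‖u x‖ ^ 2 := by
    rw [EuclideanSpace.norm_eq, Real.sq_sqrt (Finset.sum_nonneg fun i _ => by positivity)]
    simp only [Fin.sum_univ_three, Real.norm_eq_abs, sq_abs]
    nlinarith [sq_nonneg (u x 2)]
  by_cases hr : x 0 ^ 2 + x 1 ^ 2 = 0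
  · rw [hr, zero_mul]; positivity
  have hr0 : 0 < x 0 ^ 2 + x 1 ^ 2 := lt_of_le_of_ne (by positivity) (Ne.symm hr)
  -- `r² (r²Φ²) = Γ² ≤ r² (u₀² + u₁²)`
  have hkey : (x 0 ^ 2 + x 1 ^ 2) * ((x 0 ^ 2 + x 1 ^ 2) * angVelQuot u x ^ 2) ≤
      (x 0 ^ 2 + x 1 ^ 2) * (u x 0 ^ 2 + u x 1 ^ 2) := by
    have h1 : (x 0 ^ 2 + x 1 ^ 2) * ((x 0 ^ 2 + x 1 ^ 2) * angVelQuot u x ^ 2) = swirl u x ^ 2 := by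
      rw [← hΓ]; ring
    rw [h1, swirl]
    nlinarith [sq_nonneg (x 0 * u x 0 + x 1 * u x 1)]
  exact (le_of_mul_le_mul_left hkey hr0).trans hn

variable {S : Set ℝ} {ν : ℝ} {v : ℝ → EuclideanSpace ℝ (Fin 3) → EuclideanSpace ℝ (Fin 3)}
  {q : ℝ → EuclideanSpace ℝ (Fin 3) → ℝ}

/-- **The `L⁴`-energy identity of `V = v^θ/√r` along an axisymmetric Navier–Stokes flow**
(Lei–Zhang 2017, (7-2), as an identity at a fixed time, before estimating `‖vʳ/r‖_∞`): for a
classical solution of the unforced system with viscosity `ν` on a time set `S` of unique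
differentiability with axisymmetric velocity, at `t ∈ S`, with `Φ = angVelQuot (v t) = v^θ/r`,
`Φ' = angVelQuot (∂ₜv t)`, `W = radVelQuot (v t) = vʳ/r`: if `Φ, ∂ᵢΦ, ∂ᵢ∂ᵢΦ, Φ' ∈ L²`, `Φ`, `W`
bounded and `v t` bounded with bounded derivative, then
`∫ r² Φ³ Φ' = −3ν ∫ r² Φ² |∇Φ|² − (3/2) ∫ r² W Φ⁴`, i.e.
`d/dt ‖V²‖²_{L²} = −12ν ∫ r²Φ²|∇Φ|² − 6 ∫ (vʳ/r) r²Φ⁴` (`‖V²‖²_{L²} = ∫ r²Φ⁴`,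
`4∫ r²Φ²|∇Φ|² = ‖∇V²‖² + ‖r⁻¹V²‖²`). [cite: LeiZhang2017, §4 (7-2) (p. 10)] -/
theorem IsClassicalNSSolutionOn.integral_horizSq_mul_angVelQuot_cube_eq
    (hcl : IsClassicalNSSolutionOn S ν 0 v q) (hS : UniqueDiffOn ℝ S)
    (hax : ∀ s ∈ S, IsAxisymmetric (v s)) {t : ℝ} (ht : t ∈ S)
    (h0 : MemLp (angVelQuot (v t)) 2 volume)
    (h1 : ∀ i : Fin 3, MemLp (fun x => fderiv ℝ (angVelQuot (v t)) x (EuclideanSpace.single i 1)) 2 volume)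
    (h2 : ∀ i : Fin 3, MemLp (fun x => fderiv ℝ (fun y => fderiv ℝ (angVelQuot (v t)) y
      (EuclideanSpace.single i 1)) x (EuclideanSpace.single i 1)) 2 volume)
    (hG' : MemLp (angVelQuot (timeDerivWithin S v t)) 2 volume)
    {BG : ℝ} (hGB : ∀ x, |angVelQuot (v t) x| ≤ BG)
    {B : ℝ} (hbB : ∀ x, ‖v t x‖ ≤ B) {B' : ℝ} (hDb : ∀ x, ‖fderiv ℝ (v t) x‖ ≤ B')
    {BW : ℝ} (hWB : ∀ x, |radVelQuot (v t) x| ≤ BW) :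
    ∫ x, (x 0 ^ 2 + x 1 ^ 2) * angVelQuot (v t) x ^ 3 * angVelQuot (timeDerivWithin S v t) x =
      -3 * ν * (∫ x, (x 0 ^ 2 + x 1 ^ 2) * angVelQuot (v t) x ^ 2 *
          (fderiv ℝ (angVelQuot (v t)) x (EuclideanSpace.single 0 1) ^ 2 +
            fderiv ℝ (angVelQuot (v t)) x (EuclideanSpace.single 1 1) ^ 2 +
            fderiv ℝ (angVelQuot (v t)) x (EuclideanSpace.single 2 1) ^ 2))
        - 3 / 2 * ∫ x, (x 0 ^ 2 + x 1 ^ 2) * radVelQuot (v t) x * angVelQuot (v t) x ^ 4 := by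
  have hv : ContDiff ℝ ∞ (v t) := hcl.contDiff_velocity ht
  have hv2 : ContDiff ℝ 2 (v t) := hv.of_le (by norm_cast)
  have hv4 : ContDiff ℝ 4 (v t) := hv.of_le (by norm_cast)
  have hv1 : ContDiff ℝ 1 (v t) := hv.of_le (by norm_cast)
  have hΦ2 : ContDiff ℝ 2 (angVelQuot (v t)) := contDiff_angVelQuot (n := 2) hv4
  have hΦax : IsAxisymmetricScalar (angVelQuot (v t)) := (hax t ht).isAxisymmetricScalar_angVelQuot hv2
  have hW2 : ContDiff ℝ 2 (radVelQuot (v t)) := contDiff_radVelQuot (n := 2) hv4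
  have hB₂ : ∀ x : EuclideanSpace ℝ (Fin 3), (x 0 ^ 2 + x 1 ^ 2) * angVelQuot (v t) x ^ 2 ≤ B ^ 2 :=
    fun x => ((hax t ht).horizSq_mul_angVelQuot_sq_le hv2 x).trans
      (pow_le_pow_left₀ (norm_nonneg _) (hbB x) 2)
  have hW : ∀ x : EuclideanSpace ℝ (Fin 3), x 0 * v t x 0 + x 1 * v t x 1 =
      (x 0 ^ 2 + x 1 ^ 2) * radVelQuot (v t) x := fun x => by
    rw [← cylRadius_sq, (hax t ht).cylRadius_sq_mul_radVelQuot hv2 x]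
  exact integral_horizSq_mul_cube_mul_eq_of_phi_eq hΦ2 hΦax hv1 (hcl.divFree t ht) hW2.continuous
    h0 h1 h2 hG' hGB hB₂ hbB hDb hWB hW (fun x => hcl.angVelQuot_eq hS hax ht x)

end NS

end Literature.Analysis.FluidPDE

end
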